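/-
Copyright (c) 2026 the pub-hodgecm-mathlib formalisation cell (harness21).  Prover seat hodgecm-mathlib-LH4-p12 (g5), Track A «(D-RAM) FOUR-FRAME», unit U2H, the (ρ2b′-X)
census road — typed bottom socket (B) (payer LH4-p14 (g4) 06:33:09Z: «(B) → LH4-p07 (g7) + p12»), brick (B-0) «THE ONE-FIELD RamK FRAME AT THE CM PLACE» (LH4-p07 (g7)'s
split 06:34:12Z).  2026-09-04.
-/
import Summits.HodgeConjecture.HodgeConjecture.Theorems.F0P3cDyRamTypeUThirdFieldDichotomy           -- ★ p857868 (LH4-p05 (g4)): `v_sub_map_lt_one_of_ramK`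
import Literature.NumberTheory.LocalFields.ValuedFixedFieldRamifiedOfNe                           -- ★ p857938 (this seat): `even_order_of_fixed`
import Literature.NumberTheory.Automorphic.Liu2021.LemD1AsPrintedIndexedNonVacuityRamifiedConverse  -- ★ `valued_galAdicCompletionMap_sub_lt_one_of_ramified`
import Literature.NumberTheory.Automorphic.QuadraticLocalBaseChange                                -- ★ `toPlace`, `valued_toPlace`
import Literature.NumberTheory.Automorphic.AdicCompletionCompact                                   -- ★ `finite_residueField_adicCompletion`
import Literature.NumberTheory.Automorphic.UnitaryThreeFourFrameDefs                               -- D `IsRamifiedQuadraticDatum`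
import Summits.HodgeConjecture.HodgeConjecture.Theorems.F0P3cDyRamUnramifiedQuadraticCompletionDictionary  -- ★ p857937 + ED. 2 p857979 (LH4-p10 (g3)): (S2′-E) α-keyed dictionary
import Summits.HodgeConjecture.HodgeConjecture.Theorems.F0P3cDyRamKleinDifferentLetters                   -- ★ p858036∕p858053 (F0P3a-p01 (g34)): `v_sub_map_eq_of_uniformizer` (depth is uniformiser-free)
import HarnessLib

/-!
# F0 · P3c · line LH4 «(D-RAM) FOUR-FRAME» — unit U2H, leaf (ρ2b′-X), typed bottom (B): brick (B-0) — THE ONE-FIELD RamK FRAME AT THE CM PLACE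

Cell `pub/hodgecm-mathlib` (D-0151), crux H413 = `stmt-HodgeConjecture-24833` (helper lane `--supports`, count-neutral); THEOREMS ONLY (no definition, no instance, no notation, no
named fact, no `sorry`).  Socket served: (B) `SOCKET-hOCB.v1.LH4p14g4.txt` 17cfa65daaa478aa (the RamK bottom of ★ p857960 `…TypeSplit.orderCountCensus2_of_types`), whose HEAD is
LH4-p07 (g7)'s; this file is its brick (B-0): at the CM place `w ∣ v` of `L ∕ L⁺` (RAMIFIED, `he`) and the line model `M := E′_{w₁}` over `L_w` (`ρ := (c₁)_{w₁}`, `jE := ι_{w₁} =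
toPlace w.1 w₁`, the abstract involution `Θ` with `Θ ∘ jE = jE ∘ σ_w`), turn the CM letters plus the TYPE-B definers `|α − ρα| = 1` (through its consequence `|jE a| = |a|`, i.e.
`e(w₁|w) = 1` — LH4-p10 (g3)'s (S2′-E) dictionary) and `|α − Θα| < 1` into the ONE-FIELD RamK FRAME LETTERS consumed by ★ p857929
`…ToricLevelCensusRamKAtThirdField.exists_thirdFieldPackage_ramK` ∕ the T5b rows ∕ the RamK weld:

* `v_map_sub_lt_one_of_fixed` — **`hσres`**: `ρ`-fixed integers of `M` are residually `Θ`-fixed (`σ_w ≡ id mod 𝔪_w` at the ramified `w`, ★ Liu2021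
  `valued_galAdicCompletionMap_sub_lt_one_of_ramified`, transported along `jE` by ★ `valued_toPlace`);
* `v_sub_map_lt_one_of_ramK_at_place` — **`hΘres`**: `|z − Θz| < 1` for every integer `z` of `M` (★ p857868 `v_sub_map_lt_one_of_ramK`);
* `exists_map_ne_self_at_place` — **`hΘne`**: `Θ ≠ id` (`Θ (jE ϖ) = jE (σ_w ϖ) ≠ jE ϖ` by the datum's depth clause);
* `isRamifiedQuadraticDatum_transport` — **`hDΘ : IsRamifiedQuadraticDatum Θ (jE ϖ) d tE` ON `M`**: the `σ_w`-datum on `L_w` transported along the ISOMETRIC `jE` — clause 4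
  (EVEN ORDER of Θ-fixed elements, which is NOT a transport) by ★ p857938 `even_order_of_fixed` at `P := jE (ϖ·σ_w ϖ)`;
* `ramK_frame_at_place` — the bundle (all four at once) under the socket's letters + `hjE : ∀ a, |jE a| = |a|`.
The residue-count letter `#𝓀[M] = q_w²` and `hjE` itself are LH4-p10 (g3)'s ★∕pending (S2′-E) dictionary (`natCard_residueField_eq_sq_of_isUnramifiedIn` + ED. 2's α-keyed
`|α − ρα| = 1 ⇒ e(w₁|w) = 1`); they are INPUTS here and are discharged in the (B) HEAD.
HONEST LABEL: HC_CM is proved only modulo the 7 printed citations (2 remaining named inputs: hLiu418 = stmt-HodgeConjecture-24832, h413 = stmt-HodgeConjecture-24833) until rung 0 closes;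
socket (B) is OPEN — this brick closes no socket by itself; count-neutral.

## References
* [Rogawski1990] J. D. Rogawski, *Automorphic Representations of Unitary Groups in Three Variables*, Ann. of Math. Stud. 123 (1990), §4.9 Lemma 4.9.3 p. 56 (the eigen-field of a type-(2)
  element and its two commuting involutions).
* [NeukirchANT1999] J. Neukirch, *Algebraic Number Theory*, Grundlehren 322 (1999), Ch. I §9 Prop. (9.6), Ch. II §4 Prop. (4.3) (decomposition ∕ inertia at a non-split place).
* [Serre1979] J.-P. Serre, *Local Fields*, GTM 67 (1979), Ch. I §4 Prop. 10.
-/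

set_option autoImplicit false

noncomputable section

namespace Summit.HodgeConjecture.HodgeConjecture.Cruxes.H413.F0P3cDyRamFrameRamKAtPlace

open NumberField IsDedekindDomain WithZero
open Literature.NumberTheory.Automorphic Literature.NumberTheory.Automorphic.UnitaryGroup
open Literature.NumberTheory.Automorphic.UnitaryThreeFourFrame
open Literature.NumberTheory.LocalFields.ValuedFixedFieldRamified
open scoped Valued

variable (L : Type) [Field L] [NumberField L] [IsCMField L] {v : HeightOneSpectrum (𝓞 ↥(maximalRealSubfield L))}
  (w : UnitaryGroup.PlacesOver L v) (hw : IsCMField.complexConj L • w.1 = w.1)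
  (E' : Type) [Field E'] [NumberField E'] [Algebra L E'] (c₁ : E' ≃ₐ[L] E') (w₁ : UnitaryGroup.PlacesOver E' w.1) (hw₁ : c₁ • w₁.1 = w₁.1)

/-! ## §1 `hσres`: `ρ`-fixed integers of `M` are residually `Θ`-fixed (the place `w` is ramified in `L ∕ L⁺`) -/

/-- **`hσres` AT THE CM PLACE.**  If `Θ ∘ ι_{w₁} = ι_{w₁} ∘ σ_w` and the `ρ`-fixed elements of `M = E′_{w₁}` are exactly `ι_{w₁}(L_w)`, then for every `ρ`-fixed integer `z` of `M`,
`|Θ z − z| < 1` — because `σ_w ≡ id (mod 𝔪_w)` at the RAMIFIED `w` and `|ι_{w₁} t| = |t|^{e(w₁|w)}`, `e ≠ 0`. [cite: NeukirchANT1999, Ch. I §9 Prop. (9.6)] -/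
theorem v_map_sub_lt_one_of_fixed (he : v.asIdeal.ramificationIdx' w.1.asIdeal ≠ 1)
    (Θ : w₁.1.adicCompletion E' →+* w₁.1.adicCompletion E')
    (hjle1 : ∀ a, Valued.v (toPlace w.1 w₁ a) ≤ 1 ↔ Valued.v a ≤ 1)
    (hjfix : ∀ z : w₁.1.adicCompletion E', galAdicCompletionMap (L := E') c₁ hw₁ z = z ↔ ∃ a, toPlace w.1 w₁ a = z)
    (hΘj : ∀ a, Θ (toPlace w.1 w₁ a) = toPlace w.1 w₁ ((galAdicCompletionMap (L := L) (IsCMField.complexConj L) hw) a))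
    (z : w₁.1.adicCompletion E') (hz : galAdicCompletionMap (L := E') c₁ hw₁ z = z) (hz1 : Valued.v z ≤ 1) :
    Valued.v (Θ z - z) < 1 := by
  haveI : Algebra.IsQuadraticExtension ↥(maximalRealSubfield L) L := IsCMField.isQuadraticExtension L
  have hc1 : IsCMField.complexConj L ≠ 1 := IsCMField.complexConj_ne_one L
  have he0 : w.1.asIdeal.ramificationIdx' w₁.1.asIdeal ≠ 0 := by
    intro h0
    have h1 := valued_toPlace w.1 w₁ (0 : w.1.adicCompletion L)
    rw [map_zero, map_zero, h0, pow_zero] at h1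
    exact zero_ne_one h1
  obtain ⟨a, rfl⟩ := (hjfix z).1 hz
  have ha1 : Valued.v a ≤ 1 := (hjle1 a).1 hz1
  rw [hΘj, ← map_sub, valued_toPlace w.1 w₁]
  exact pow_lt_one₀ zero_le
    (Liu2021.LemD1IndexedNonVacuityRamifiedConverse.valued_galAdicCompletionMap_sub_lt_one_of_ramified L (IsCMField.complexConj L) v hc1 w hw he a ha1) he0

/-! ## §2 `hΘres` and `hΘne` -/

/-- **`hΘres` AT THE CM PLACE (type B)**: under the socket's frame letters and the type-B definers `|α − ρα| = 1`, `|α − Θα| < 1`, every integer `z` of `M` has `|z − Θz| < 1`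
(★ p857868 `v_sub_map_lt_one_of_ramK` over §1's `hσres`). [cite: Serre1979, Ch. I §4 Prop. 10] -/
theorem v_sub_map_lt_one_of_ramK_at_place (he : v.asIdeal.ramificationIdx' w.1.asIdeal ≠ 1)
    (Θ : w₁.1.adicCompletion E' →+* w₁.1.adicCompletion E') {α : w₁.1.adicCompletion E'}
    (hρρ : ∀ z, galAdicCompletionMap (L := E') c₁ hw₁ (galAdicCompletionMap (L := E') c₁ hw₁ z) = z)
    (hvρ : ∀ z, Valued.v (galAdicCompletionMap (L := E') c₁ hw₁ z) = Valued.v z)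
    (hjle1 : ∀ a, Valued.v (toPlace w.1 w₁ a) ≤ 1 ↔ Valued.v a ≤ 1)
    (hjfix : ∀ z : w₁.1.adicCompletion E', galAdicCompletionMap (L := E') c₁ hw₁ z = z ↔ ∃ a, toPlace w.1 w₁ a = z)
    (hΘj : ∀ a, Θ (toPlace w.1 w₁ a) = toPlace w.1 w₁ ((galAdicCompletionMap (L := L) (IsCMField.complexConj L) hw) a))
    (hvΘ : ∀ z, Valued.v (Θ z) = Valued.v z) (hα1 : Valued.v α ≤ 1)
    (hα : Valued.v (α - galAdicCompletionMap (L := E') c₁ hw₁ α) = 1) (hram : Valued.v (α - Θ α) < 1)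
    (z : w₁.1.adicCompletion E') (hz : Valued.v z ≤ 1) : Valued.v (z - Θ z) < 1 :=
  F0P3cDyRamTypeUThirdFieldDichotomy.v_sub_map_lt_one_of_ramK hρρ hvρ hvΘ
    (v_map_sub_lt_one_of_fixed L w hw E' c₁ w₁ hw₁ he Θ hjle1 hjfix hΘj) hα1 hα hram z hz

/-- **`hΘne` AT THE CM PLACE**: `Θ ≠ id` on `M` — `Θ (ι ϖ) = ι (σ_w ϖ) ≠ ι ϖ`, since the datum's depth clause `|ϖ − σ_w ϖ| = |ϖ|^d` makes `σ_w ϖ ≠ ϖ` and `ι` is injective.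
[cite: Rogawski1990, §4.9 Lemma 4.9.3 p. 56] -/
theorem exists_map_ne_self_at_place (Θ : w₁.1.adicCompletion E' →+* w₁.1.adicCompletion E')
    (hΘj : ∀ a, Θ (toPlace w.1 w₁ a) = toPlace w.1 w₁ ((galAdicCompletionMap (L := L) (IsCMField.complexConj L) hw) a))
    {ϖ : w.1.adicCompletion L} {d tE : ℕ} (hD : IsRamifiedQuadraticDatum (galAdicCompletionMap (L := L) (IsCMField.complexConj L) hw) ϖ d tE) :
    ∃ x : w₁.1.adicCompletion E', Θ x ≠ x := by
  obtain ⟨-, -, hϖ, -, hdd, -, -⟩ := hD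
  refine ⟨toPlace w.1 w₁ ϖ, fun h => ?_⟩
  rw [hΘj] at h
  have h' : (galAdicCompletionMap (L := L) (IsCMField.complexConj L) hw) ϖ = ϖ := (toPlace w.1 w₁).injective h
  rw [h', sub_self, map_zero] at hdd
  rw [hϖ] at hdd
  exact (pow_ne_zero d exp_ne_zero) hdd.symm

/-! ## §3 The Θ-datum on `M`: transport of the `σ_w`-datum along the isometric `ι_{w₁}` -/

/-- **`hDΘ : IsRamifiedQuadraticDatum Θ (ι ϖ) d tE` ON `M = E′_{w₁}`** from the `σ_w`-datum on `L_w`, when `ι = ι_{w₁}` is ISOMETRIC (`|ι a| = |a|`, i.e. `e(w₁|w) = 1`, the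
type-B∕type-A situation): clauses 1–3 and 5–7 are transports (`Θ ∘ ι = ι ∘ σ_w`, `ι 2 = 2`); clause 4 (every Θ-fixed `z ≠ 0` has EVEN order) is ★ `even_order_of_fixed` at
`P := ι(ϖ·σ_w ϖ)` (`Θ`-fixed, `|P| = exp(−2)`), from `Θ ≠ id` (§2) and `hΘres`.  [cite: Serre1979, Ch. I §4 Prop. 10] [cite: Rogawski1990, §4.9 Lemma 4.9.3 p. 56] -/
theorem isRamifiedQuadraticDatum_transport (Θ : w₁.1.adicCompletion E' →+* w₁.1.adicCompletion E')
    (hΘΘ : ∀ z, Θ (Θ z) = z) (hvΘ : ∀ z, Valued.v (Θ z) = Valued.v z)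
    (hΘj : ∀ a, Θ (toPlace w.1 w₁ a) = toPlace w.1 w₁ ((galAdicCompletionMap (L := L) (IsCMField.complexConj L) hw) a))
    (hjE : ∀ a, Valued.v (toPlace w.1 w₁ a) = Valued.v a)
    (hΘres : ∀ z : w₁.1.adicCompletion E', Valued.v z ≤ 1 → Valued.v (z - Θ z) < 1)
    {ϖ : w.1.adicCompletion L} {d tE : ℕ} (hD : IsRamifiedQuadraticDatum (galAdicCompletionMap (L := L) (IsCMField.complexConj L) hw) ϖ d tE) :
    IsRamifiedQuadraticDatum Θ (toPlace w.1 w₁ ϖ) d tE := by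
  haveI : Finite 𝓀[w₁.1.adicCompletion E'] := finite_residueField_adicCompletion E' w₁.1
  have hΘne := exists_map_ne_self_at_place L w hw E' w₁ Θ hΘj hD
  obtain ⟨hσσ, hvσ, hϖ, -, hdd, hd, h2⟩ := hD
  set σ := galAdicCompletionMap (L := L) (IsCMField.complexConj L) hw with hσdef
  -- the Θ-fixed `P := ι(ϖ·σϖ)` of order `2`
  have hΘP : Θ (toPlace w.1 w₁ (ϖ * σ ϖ)) = toPlace w.1 w₁ (ϖ * σ ϖ) := by
    rw [hΘj, map_mul, hσσ, mul_comm]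
  have hP : Valued.v (toPlace w.1 w₁ (ϖ * σ ϖ)) = exp (-2 : ℤ) := by
    rw [hjE, map_mul, hvσ, hϖ, ← exp_add]; rfl
  refine ⟨hΘΘ, hvΘ, by rw [hjE, hϖ], fun z hz hz0 => even_order_of_fixed hΘΘ hvΘ hΘres hΘne hΘP hP z hz hz0, ?_, hd, ?_⟩
  · rw [hΘj, ← map_sub, hjE, hjE, hdd]
  · rw [show (2 : w₁.1.adicCompletion E') = toPlace w.1 w₁ 2 from (map_ofNat _ 2).symm, hjE, hjE, h2]

/-! ## §4 The bundle -/

/-- **(B-0) THE ONE-FIELD RamK FRAME AT THE CM PLACE, BUNDLED**: under socket (B)'s frame letters (`ρρ = 1`, `ρ` isometric, `|ι a| ≤ 1 ↔ |a| ≤ 1`, `Fix ρ = ι(L_w)`,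
`Θ ∘ ι = ι ∘ σ_w`, `ΘΘ = 1`, `Θ` isometric, `|α| ≤ 1`) and its type-B definers `|α − ρα| = 1`, `|α − Θα| < 1`, together with the ISOMETRY `|ι a| = |a|` (the (S2′-E) reading of
`|α − ρα| = 1`), at the RAMIFIED CM place (`he`, datum `hD`): **`hσres ∧ hΘres ∧ (Θ ≠ id) ∧ IsRamifiedQuadraticDatum Θ (ι ϖ) d tE`**.
[cite: Rogawski1990, §4.9 Lemma 4.9.3 p. 56] [cite: NeukirchANT1999, Ch. I §9 Prop. (9.6)] [cite: Serre1979, Ch. I §4 Prop. 10] -/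
theorem ramK_frame_at_place (he : v.asIdeal.ramificationIdx' w.1.asIdeal ≠ 1)
    {ϖ : w.1.adicCompletion L} {d tE : ℕ} (hD : IsRamifiedQuadraticDatum (galAdicCompletionMap (L := L) (IsCMField.complexConj L) hw) ϖ d tE)
    (Θ : w₁.1.adicCompletion E' →+* w₁.1.adicCompletion E') {α : w₁.1.adicCompletion E'}
    (hρρ : ∀ z, galAdicCompletionMap (L := E') c₁ hw₁ (galAdicCompletionMap (L := E') c₁ hw₁ z) = z)
    (hvρ : ∀ z, Valued.v (galAdicCompletionMap (L := E') c₁ hw₁ z) = Valued.v z)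
    (hjle1 : ∀ a, Valued.v (toPlace w.1 w₁ a) ≤ 1 ↔ Valued.v a ≤ 1)
    (hjfix : ∀ z : w₁.1.adicCompletion E', galAdicCompletionMap (L := E') c₁ hw₁ z = z ↔ ∃ a, toPlace w.1 w₁ a = z)
    (hΘj : ∀ a, Θ (toPlace w.1 w₁ a) = toPlace w.1 w₁ ((galAdicCompletionMap (L := L) (IsCMField.complexConj L) hw) a))
    (hΘΘ : ∀ z, Θ (Θ z) = z) (hvΘ : ∀ z, Valued.v (Θ z) = Valued.v z) (hα1 : Valued.v α ≤ 1)
    (hα : Valued.v (α - galAdicCompletionMap (L := E') c₁ hw₁ α) = 1) (hram : Valued.v (α - Θ α) < 1)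
    (hjE : ∀ a, Valued.v (toPlace w.1 w₁ a) = Valued.v a) :
    (∀ z : w₁.1.adicCompletion E', galAdicCompletionMap (L := E') c₁ hw₁ z = z → Valued.v z ≤ 1 → Valued.v (Θ z - z) < 1) ∧
    (∀ z : w₁.1.adicCompletion E', Valued.v z ≤ 1 → Valued.v (z - Θ z) < 1) ∧
    (∃ x : w₁.1.adicCompletion E', Θ x ≠ x) ∧
    IsRamifiedQuadraticDatum Θ (toPlace w.1 w₁ ϖ) d tE := by
  have hΘres := v_sub_map_lt_one_of_ramK_at_place L w hw E' c₁ w₁ hw₁ he Θ hρρ hvρ hjle1 hjfix hΘj hvΘ hα1 hα hram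
  exact ⟨v_map_sub_lt_one_of_fixed L w hw E' c₁ w₁ hw₁ he Θ hjle1 hjfix hΘj, hΘres, exists_map_ne_self_at_place L w hw E' w₁ Θ hΘj hD,
    isRamifiedQuadraticDatum_transport L w hw E' w₁ Θ hΘΘ hvΘ hΘj hjE hΘres hD⟩

/-! ## §5 The bundle keyed on the type letter alone (the isometry of `ι_{w₁}` and `#𝓀[M] = q_w²` from LH4-p10 (g3)'s ★ (S2′-E) dictionary) -/

/-- **(B-0) THE ONE-FIELD RamK FRAME AT THE CM PLACE, KEYED ON THE TYPE LETTERS ONLY**: as ★ `ramK_frame_at_place`, with the isometry `|ι a| = |a|` DERIVED from `|α − ρα| = 1`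
(★ `valued_toPlace_of_v_sub_galAdicCompletionMap_eq_one`, (S2′-E)) and two more conjuncts appended: `∀ a, |ι a| = |a|` and `#𝓀[M] = #𝓀[L_w]²` (★
`natCard_residueField_eq_sq_of_v_sub_galAdicCompletionMap_eq_one`).  Needs `[Algebra.IsQuadraticExtension L E']` and `c₁ ≠ 1` (socket letters).
[cite: Rogawski1990, §4.9 Lemma 4.9.3 p. 56] [cite: NeukirchANT1999, Ch. I §9 Prop. (9.6), Ch. II §4 Prop. (4.3)] [cite: Serre1979, Ch. I §4 Prop. 10] -/
theorem ramK_frame_at_place' [Algebra.IsQuadraticExtension L E'] (hc₁ : c₁ ≠ 1) (he : v.asIdeal.ramificationIdx' w.1.asIdeal ≠ 1)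
    {ϖ : w.1.adicCompletion L} {d tE : ℕ} (hD : IsRamifiedQuadraticDatum (galAdicCompletionMap (L := L) (IsCMField.complexConj L) hw) ϖ d tE)
    (Θ : w₁.1.adicCompletion E' →+* w₁.1.adicCompletion E') {α : w₁.1.adicCompletion E'}
    (hρρ : ∀ z, galAdicCompletionMap (L := E') c₁ hw₁ (galAdicCompletionMap (L := E') c₁ hw₁ z) = z)
    (hvρ : ∀ z, Valued.v (galAdicCompletionMap (L := E') c₁ hw₁ z) = Valued.v z)
    (hjle1 : ∀ a, Valued.v (toPlace w.1 w₁ a) ≤ 1 ↔ Valued.v a ≤ 1)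
    (hjfix : ∀ z : w₁.1.adicCompletion E', galAdicCompletionMap (L := E') c₁ hw₁ z = z ↔ ∃ a, toPlace w.1 w₁ a = z)
    (hΘj : ∀ a, Θ (toPlace w.1 w₁ a) = toPlace w.1 w₁ ((galAdicCompletionMap (L := L) (IsCMField.complexConj L) hw) a))
    (hΘΘ : ∀ z, Θ (Θ z) = z) (hvΘ : ∀ z, Valued.v (Θ z) = Valued.v z) (hα1 : Valued.v α ≤ 1)
    (hα : Valued.v (α - galAdicCompletionMap (L := E') c₁ hw₁ α) = 1) (hram : Valued.v (α - Θ α) < 1) :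
    (∀ z : w₁.1.adicCompletion E', galAdicCompletionMap (L := E') c₁ hw₁ z = z → Valued.v z ≤ 1 → Valued.v (Θ z - z) < 1) ∧
    (∀ z : w₁.1.adicCompletion E', Valued.v z ≤ 1 → Valued.v (z - Θ z) < 1) ∧
    (∃ x : w₁.1.adicCompletion E', Θ x ≠ x) ∧
    IsRamifiedQuadraticDatum Θ (toPlace w.1 w₁ ϖ) d tE ∧
    (∀ a, Valued.v (toPlace w.1 w₁ a) = Valued.v a) ∧
    Nat.card 𝓀[w₁.1.adicCompletion E'] = Nat.card 𝓀[w.1.adicCompletion L] ^ 2 := by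
  have hjE : ∀ a, Valued.v (toPlace w.1 w₁ a) = Valued.v a :=
    F0P3cDyRamUnramifiedQuadraticCompletionDictionary.valued_toPlace_of_v_sub_galAdicCompletionMap_eq_one E' c₁ w.1 hc₁ w₁ hw₁ hα1 hα
  obtain ⟨h1, h2, h3, h4⟩ := ramK_frame_at_place L w hw E' c₁ w₁ hw₁ he hD Θ hρρ hvρ hjle1 hjfix hΘj hΘΘ hvΘ hα1 hα hram hjE
  exact ⟨h1, h2, h3, h4, hjE,
    F0P3cDyRamUnramifiedQuadraticCompletionDictionary.natCard_residueField_eq_sq_of_v_sub_galAdicCompletionMap_eq_one E' c₁ w.1 hc₁ w₁ hw₁ hα1 hα⟩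

/-! ## §6 (dK-2) The `ρ`-depth of a `τ`-fixed uniformiser of `M` is the Θ-datum's `d` (one-field; the `dK = d` bridge of socket (B)'s H-side) -/

/-- **(dK-2) ONE-FIELD**: if `Θ` carries a ramified quadratic datum of depth `d` on `M` (e.g. ★ `isRamifiedQuadraticDatum_transport`'s `IsRamifiedQuadraticDatum Θ (ι ϖ) d tE`,
i.e. `d(M ∕ K♮) = d(E ∕ F)` at type B) and `ρ` is any ring map, then every `τ := Θρ`-FIXED uniformiser `π` of `M` (`Θ (ρ π) = π`, `|π| = exp(−1)`; these are the
uniformisers of `K″ = Fix τ`, over which `M` is unramified) has `ρ`-DEPTH `d`: **`|π − ρ π| = |π|^d`** — because `Θ π = ρ π` and the Θ-depth is the same at every uniformiser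
(★ `KleinDifferentLetters.v_sub_map_eq_of_uniformizer`).  With LH4-p09's Eisenstein root `π` of `x² − uτ·x − wτ` this reads `v_F(uτ² + 4wτ) = d`, i.e. `dK = d`.
[cite: Serre1979, Ch. III §4 Prop. 8; Ch. IV §1 Prop. 4] [cite: NeukirchANT1999, Ch. II §4 Prop. (4.3)] -/
theorem v_sub_rho_eq_of_tau_fixed {M : Type} [Field M] [Valued M ℤᵐ⁰] (ρ Θ : M →+* M) (hΘΘ : ∀ z, Θ (Θ z) = z)
    {ϖE : M} {d t : ℕ} (hDΘ : IsRamifiedQuadraticDatum Θ ϖE d t)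
    {π : M} (hτπ : Θ (ρ π) = π) (hπ : Valued.v π = exp (-1 : ℤ)) :
    Valued.v (π - ρ π) = Valued.v π ^ d := by
  obtain ⟨hΘΘ', hvΘ, hϖE, hfix, hdd, -, -⟩ := hDΘ
  have hΘπ : Θ π = ρ π := by
    have h := congrArg Θ hτπ
    rw [hΘΘ] at h
    exact h.symm
  rw [← hΘπ, hπ, ← hϖE]
  exact F0P3cDyRamKleinDifferentLetters.v_sub_map_eq_of_uniformizer hΘΘ' hvΘ hfix hϖE hdd (by rw [hπ, hϖE])

end Summit.HodgeConjecture.HodgeConjecture.Cruxes.H413.F0P3cDyRamFrameRamKAtPlace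

end
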